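import Summits.Ventures.LatticeQCDFlow.Scoring.WilsonFlowReflectionCovariance
import Literature.MathematicalPhysics.QuantumLattice.CloverObservables
import HarnessLib

/-!
# The law of the (flowed) clover charge under the Wilson measure is symmetric: tails match and all odd moments vanish

HONEST FRAMING: exact (Metropolis-corrected) sampling algorithms for lattice gauge theory;
figures of merit are autocorrelation/cost numbers at stated couplings and volumes; no
continuum-physics claim.

Venture `LatticeQCDFlow` (cell pub-lqcd), sub-topic `Scoring`; FANOUT row 16 (`su2-base`).  NEW WORK of
the cell (placement rule); fourth file of the `⟨Q⟩ = 0` packet (`Scoring/CloverChargeMeanZero`,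
`Scoring/WilsonFlowReflectionCovariance`, `Scoring/CloverDensityMeanZero`).  The mean is only the first
odd moment: the same measure-preserving involution `Θ'` (`WilsonSiteRP.negReflectEquiv`,
`measurePreserving_negReflect_wilsonMeasure` of the Literature's `SpeciesTimeReflection`) makes the whole
LAW of any `Θ'`-odd observable symmetric about `0`.  Used as run checks: the `Q`-histogram of an exact
chain must be symmetric within errors, `P(Q ≥ c) = P(Q ≤ −c)`, and `⟨Q³⟩ = ⟨Q⁵⟩ = … = 0`.  Nothing is
cited as a fact.  Printed counterpart, NAMED ONLY: the parity argument (Lüscher 2010 §3; any topology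
measurement paper's "the distribution of `Q` is symmetric").

## What is proved

* §1 (abstract: `e : α ≃ᵐ α` preserving `μ`, `F ∘ e = −F`, real-valued `F`)
  `integral_comp_eq_integral_comp_neg_of_odd` (`∫ g(F) = ∫ g(−F)` for every `g`, no measurability),
  `measure_setOf_odd_symm` (`μ{F ∈ A} = μ{−F ∈ A}` for EVERY set `A`), `measure_le_eq_measure_le_neg_of_odd`
  (`μ{c ≤ F} = μ{F ≤ −c}`), `map_neg_map_of_odd` (the push-forward law is `Neg`-invariant, `F`
  a.e.-measurable), `integral_pow_odd_eq_zero_of_odd` (`∫ F^{2k+1} = 0`).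
* §2 (torus `(ℤ/L)^d`, compact `G`, continuous `ρ`, every real `β`; `F ∘ Θ' = −F`) the same four facts
  for `μ_{Λ,β} = wilsonMeasure ρ β` / `wilsonExpectation ρ β`.
* §3 (`SU(n)`, fundamental representation, `d = 4`, every `L ≥ 1`, `β`, flow time `t`) for the flowed
  total clover charge `Q_t(U) = Σ_x P_x(V_t U)` (odd by `sum_cloverPseudoscalar_wilsonFlow_negReflect`,
  continuous hence measurable by `continuous_wilsonFlow` and `continuous_cloverPseudoscalar`):
  **`wilsonMeasure_flowedCloverCharge_tail_symm`** (`μ{c ≤ Q_t} = μ{Q_t ≤ −c}` for every real `c`),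
  **`wilsonMeasure_map_flowedCloverCharge_neg_invariant`** (the law of `Q_t` is symmetric),
  **`wilsonExpectation_flowedCloverCharge_pow_odd_eq_zero`** (`⟨Q_t^{2k+1}⟩ = 0` for every `k`).

NOT CLAIMED: anything about even moments (`⟨Q_t²⟩ = χ_t V` is dynamics/physics, not symmetry),
integrality or the `t → ∞` limit; any number.
-/

noncomputable section

open Matrix MeasureTheory
open Literature.MathematicalPhysics.QuantumFieldTheory
open Literature.MathematicalPhysics.QuantumLattice (fundamentalRep continuous_fundamentalRep
  fundamentalRep_mem_unitaryGroup cloverPseudoscalar continuous_cloverPseudoscalar)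

namespace Summit.Ventures.LatticeQCDFlow.Scoring

/-! ## §1 Odd observables of a measure-preserving equivalence have a symmetric law -/

section Abstract

variable {α : Type*} [MeasurableSpace α] {μ : Measure α} (e : α ≃ᵐ α)

/-- **`∫ g(F) dμ = ∫ g(−F) dμ`** for every `g` when `F` is odd under a `μ`-preserving equivalence (no
measurability of `F` or `g` is needed: change of variables along the equivalence). -/
theorem integral_comp_eq_integral_comp_neg_of_odd {E : Type*} [NormedAddCommGroup E]
    [NormedSpace ℝ E] (he : MeasurePreserving e μ μ) {F : α → ℝ} (hF : ∀ x, F (e x) = -F x)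
    (g : ℝ → E) :
    ∫ x, g (F x) ∂μ = ∫ x, g (-F x) ∂μ := by
  have h : ∫ x, g (F (e x)) ∂μ = ∫ x, g (F x) ∂μ := he.integral_comp' (fun x => g (F x))
  rw [← h]
  simp only [hF]

/-- **`μ{F ∈ A} = μ{−F ∈ A}`** for EVERY set `A` when `F` is odd under a `μ`-preserving equivalence
(`MeasurePreserving.measure_preimage_equiv` needs no measurability). -/
theorem measure_setOf_odd_symm (he : MeasurePreserving e μ μ) {F : α → ℝ}
    (hF : ∀ x, F (e x) = -F x) (A : Set ℝ) : μ {x | F x ∈ A} = μ {x | -F x ∈ A} := by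
  have h := he.measure_preimage_equiv {x | F x ∈ A}
  rw [← h]
  simp only [Set.preimage_setOf_eq, hF]

/-- **Tail symmetry**: `μ{c ≤ F} = μ{F ≤ −c}` for every real `c`. -/
theorem measure_le_eq_measure_le_neg_of_odd (he : MeasurePreserving e μ μ) {F : α → ℝ}
    (hF : ∀ x, F (e x) = -F x) (c : ℝ) : μ {x | c ≤ F x} = μ {x | F x ≤ -c} := by
  have h := measure_setOf_odd_symm e he hF (Set.Ici c)
  simp only [Set.mem_Ici] at h
  rw [h]
  congr 1
  ext x
  simp only [Set.mem_setOf_eq]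
  constructor <;> intro hx <;> linarith

/-- **The law of an odd observable is symmetric**: `(F_* μ) ∘ (−)⁻¹ = F_* μ` (for a.e.-measurable
`F`). -/
theorem map_neg_map_of_odd (he : MeasurePreserving e μ μ) {F : α → ℝ}
    (hFm : AEMeasurable F μ) (hF : ∀ x, F (e x) = -F x) :
    (μ.map F).map Neg.neg = μ.map F := by
  have hneg : (fun x => -F x) = F ∘ e := funext fun x => (hF x).symm
  rw [AEMeasurable.map_map_of_aemeasurable measurable_neg.aemeasurable hFm]
  change μ.map (fun x => -F x) = μ.map F
  rw [hneg, ← AEMeasurable.map_map_of_aemeasurable (he.map_eq.symm ▸ hFm)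
    he.measurable.aemeasurable, he.map_eq]

/-- **Odd moments vanish**: `∫ F^{2k+1} dμ = 0` (no integrability needed: junk `0` both ways). -/
theorem integral_pow_odd_eq_zero_of_odd (he : MeasurePreserving e μ μ) {F : α → ℝ}
    (hF : ∀ x, F (e x) = -F x) (k : ℕ) : ∫ x, F x ^ (2 * k + 1) ∂μ = 0 :=
  integral_eq_zero_of_measurePreserving_odd e he fun x => by
    rw [hF, Odd.neg_pow ⟨k, rfl⟩]

end Abstract

/-! ## §2 Reflection-odd observables of the torus Wilson theory -/

section Torus

variable {d L N : ℕ} [NeZero d] [NeZero L]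
variable {G : Type*} [Group G] [TopologicalSpace G] [IsTopologicalGroup G] [CompactSpace G]
  [MeasurableSpace G] [BorelSpace G]
variable (ρ : G →* Matrix (Fin N) (Fin N) ℂ)

/-- `⟨g(F)⟩_{Λ,β} = ⟨g(−F)⟩_{Λ,β}` for every `g` when `F ∘ Θ' = −F`. -/
theorem wilsonExpectation_comp_eq_comp_neg_of_negReflect_odd {E : Type*} [NormedAddCommGroup E]
    [NormedSpace ℝ E] (hρ : Continuous ρ) (β : ℝ) {F : GaugeConfig d L G → ℝ}
    (hF : ∀ U, F U.negReflect = -F U) (g : ℝ → E) :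
    wilsonExpectation ρ β (fun U => g (F U)) = wilsonExpectation ρ β (fun U => g (-F U)) :=
  integral_comp_eq_integral_comp_neg_of_odd (WilsonSiteRP.negReflectEquiv (d := d) (L := L))
    (measurePreserving_negReflect_wilsonMeasure ρ hρ β) hF g

/-- `μ_{Λ,β}{F ∈ A} = μ_{Λ,β}{−F ∈ A}` for every set `A` when `F ∘ Θ' = −F`. -/
theorem wilsonMeasure_setOf_negReflect_odd_symm (hρ : Continuous ρ) (β : ℝ)
    {F : GaugeConfig d L G → ℝ} (hF : ∀ U, F U.negReflect = -F U) (A : Set ℝ) :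
    wilsonMeasure ρ β {U | F U ∈ A} = wilsonMeasure ρ β {U | -F U ∈ A} :=
  measure_setOf_odd_symm (WilsonSiteRP.negReflectEquiv (d := d) (L := L))
    (measurePreserving_negReflect_wilsonMeasure ρ hρ β) hF A

/-- **Tail symmetry** `μ_{Λ,β}{c ≤ F} = μ_{Λ,β}{F ≤ −c}` when `F ∘ Θ' = −F`. -/
theorem wilsonMeasure_tail_symm_of_negReflect_odd (hρ : Continuous ρ) (β : ℝ)
    {F : GaugeConfig d L G → ℝ} (hF : ∀ U, F U.negReflect = -F U) (c : ℝ) :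
    wilsonMeasure ρ β {U | c ≤ F U} = wilsonMeasure ρ β {U | F U ≤ -c} :=
  measure_le_eq_measure_le_neg_of_odd (WilsonSiteRP.negReflectEquiv (d := d) (L := L))
    (measurePreserving_negReflect_wilsonMeasure ρ hρ β) hF c

/-- **The law of a `Θ'`-odd measurable observable under `μ_{Λ,β}` is symmetric about `0`.** -/
theorem wilsonMeasure_map_neg_invariant_of_negReflect_odd (hρ : Continuous ρ) (β : ℝ)
    {F : GaugeConfig d L G → ℝ} (hFm : Measurable F) (hF : ∀ U, F U.negReflect = -F U) :
    ((wilsonMeasure ρ β).map F).map Neg.neg = (wilsonMeasure ρ β).map F :=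
  map_neg_map_of_odd (WilsonSiteRP.negReflectEquiv (d := d) (L := L))
    (measurePreserving_negReflect_wilsonMeasure ρ hρ β) hFm.aemeasurable hF

/-- **Odd moments vanish**: `⟨F^{2k+1}⟩_{Λ,β} = 0` when `F ∘ Θ' = −F`. -/
theorem wilsonExpectation_pow_odd_eq_zero_of_negReflect_odd (hρ : Continuous ρ) (β : ℝ)
    {F : GaugeConfig d L G → ℝ} (hF : ∀ U, F U.negReflect = -F U) (k : ℕ) :
    wilsonExpectation ρ β (fun U => F U ^ (2 * k + 1)) = 0 :=
  integral_pow_odd_eq_zero_of_odd (WilsonSiteRP.negReflectEquiv (d := d) (L := L))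
    (measurePreserving_negReflect_wilsonMeasure ρ hρ β) hF k

end Torus

/-! ## §3 The flowed clover charge of `SU(n)` lattice gauge theory -/

section Clover

variable {L n : ℕ} [NeZero L]

/-- The flowed total clover charge `U ↦ Σ_x P_x(V_t U)` is a continuous, hence measurable, function of
the configuration (`continuous_wilsonFlow`, `continuous_cloverPseudoscalar`). -/
theorem measurable_flowedCloverCharge (t : ℝ) :
    Measurable fun U : GaugeConfig 4 L (Matrix.specialUnitaryGroup (Fin n) ℂ) =>
      ∑ x : Site 4 L, cloverPseudoscalar (fundamentalRep (Fin n)) x (wilsonFlow t U) := by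
  refine Continuous.measurable (continuous_finsetSum _ fun x _ => ?_)
  exact (continuous_cloverPseudoscalar (fundamentalRep (Fin n)) (continuous_fundamentalRep (Fin n))
    x).comp (continuous_wilsonFlow t)

/-- **Tail symmetry of the flowed charge**: `μ_{Λ,β}{c ≤ Q_t} = μ_{Λ,β}{Q_t ≤ −c}` for every real `c`,
every flow time `t`, every `β`, `L ≥ 1`, `n` (`Q_t = Σ_x P_x ∘ V_t`). -/
theorem wilsonMeasure_flowedCloverCharge_tail_symm (n : ℕ) (β t c : ℝ) :
    wilsonMeasure (fundamentalRep (Fin n)) β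
        {U : GaugeConfig 4 L (Matrix.specialUnitaryGroup (Fin n) ℂ) |
          c ≤ ∑ x : Site 4 L, cloverPseudoscalar (fundamentalRep (Fin n)) x (wilsonFlow t U)} =
      wilsonMeasure (fundamentalRep (Fin n)) β
        {U : GaugeConfig 4 L (Matrix.specialUnitaryGroup (Fin n) ℂ) |
          ∑ x : Site 4 L, cloverPseudoscalar (fundamentalRep (Fin n)) x (wilsonFlow t U) ≤ -c} :=
  wilsonMeasure_tail_symm_of_negReflect_odd (fundamentalRep (Fin n))
    (continuous_fundamentalRep (Fin n)) β (fun U => sum_cloverPseudoscalar_wilsonFlow_negReflect t U) c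

/-- **The law of the flowed clover charge is symmetric about `0`** (push-forward of `μ_{Λ,β}` under
`Q_t` is invariant under `q ↦ −q`), every `t`, `β`, `L ≥ 1`, `n`. -/
theorem wilsonMeasure_map_flowedCloverCharge_neg_invariant (n : ℕ) (β t : ℝ) :
    ((wilsonMeasure (fundamentalRep (Fin n)) β).map
        (fun U : GaugeConfig 4 L (Matrix.specialUnitaryGroup (Fin n) ℂ) =>
          ∑ x : Site 4 L, cloverPseudoscalar (fundamentalRep (Fin n)) x (wilsonFlow t U))).map
        Neg.neg =
      (wilsonMeasure (fundamentalRep (Fin n)) β).map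
        (fun U : GaugeConfig 4 L (Matrix.specialUnitaryGroup (Fin n) ℂ) =>
          ∑ x : Site 4 L, cloverPseudoscalar (fundamentalRep (Fin n)) x (wilsonFlow t U)) :=
  wilsonMeasure_map_neg_invariant_of_negReflect_odd (fundamentalRep (Fin n))
    (continuous_fundamentalRep (Fin n)) β (measurable_flowedCloverCharge t)
    fun U => sum_cloverPseudoscalar_wilsonFlow_negReflect t U

/-- **All odd moments of the flowed clover charge vanish**: `⟨Q_t^{2k+1}⟩_{Λ,β} = 0` for every `k`,
every flow time `t`, every `β`, `L ≥ 1`, `n` (the case `k = 0` is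
`wilsonExpectation_flowedCloverCharge_eq_zero`). -/
theorem wilsonExpectation_flowedCloverCharge_pow_odd_eq_zero (n : ℕ) (β t : ℝ) (k : ℕ) :
    wilsonExpectation (fundamentalRep (Fin n)) β
      (fun U : GaugeConfig 4 L (Matrix.specialUnitaryGroup (Fin n) ℂ) =>
        (∑ x : Site 4 L, cloverPseudoscalar (fundamentalRep (Fin n)) x (wilsonFlow t U)) ^ (2 * k + 1)) =
      0 :=
  wilsonExpectation_pow_odd_eq_zero_of_negReflect_odd (fundamentalRep (Fin n))
    (continuous_fundamentalRep (Fin n)) β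
    (fun U => sum_cloverPseudoscalar_wilsonFlow_negReflect t U) k

end Clover

end Summit.Ventures.LatticeQCDFlow.Scoring

end
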